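import Literature.RingTheory.MvPolynomial.NoetherFormsGenericBounds
import Literature.RingTheory.MvPolynomial.OstrowskiResultant
import Mathlib.Algebra.Order.Antidiag.Finsupp
import Mathlib.Algebra.MvPolynomial.Funext
import Mathlib.RingTheory.MvPolynomial.Homogeneous
import HarnessLib

/-!
# Effective Noether forms, Stage II: the generic substitution and the coefficient forms

Support file for the proof of Kaltofen's Theorem 7 (`kaltofen1995_thm7`; E. Kaltofen, *Effective
Noether irreducibility forms and applications*, J. Comput. System Sci. 50 (1995) 274–295, §4 (30),
(31) and §5). In §5 Kaltofen substitutes generic affine forms into the generic degree-`d`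
polynomial `f = Σ_{|e| ≤ d} c_e X^e`, `φ₂(x, y) = f(x + v₁, w₂x + z₂y + v₂, …, wₙx + zₙy + vₙ)`,
considers the leading coefficient `λ = ldcf_x(φ₂) ∈ ℤ[c][w]` ((30)), the resultant numerator
`ρ̄ ∈ ℤ[c][v, w]` ((31)) and the minors `Δ` of §3 evaluated at the coefficients of
`ψ₂ = φ₂/λ` with denominators cleared, and defines the Noether forms as products
`c_e · σ · τ` of a top-degree coefficient variable, a `(v, w)`-coefficient `σ` of `ρ̄` and a
`(v, w, z)`-coefficient `τ` of a cleared minor ((34)).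

This file builds the corresponding generic objects for OUR Stage I forms:

* the flat ring `𝔼 n = ℤ[params ⊕ coefficients]` (`params = Fin 3 × Fin n`: `v`, `w`, `z`;
  coefficients indexed by exponents `e : Fin n →₀ ℕ`), the extraction `pcoeff m P` of the
  coefficient (a polynomial in the `c_e`) of the parameter monomial `m`, with its evaluation
  identity (`aeval_sumElim_eq`), homogeneity (`isWeightedHomogeneous_pcoeff`) and norm (`l1Norm_pcoeff_le`);
* the generic substituted polynomial `Φgen ∈ 𝔼[y][x]`, its coefficients `ϕc i j`, `lamgen = ϕc d 0`
  and — instead of dividing by `λ` — the coefficient vector `bgen (i, j) = ϕc i j · λ^{d-1-i}` of the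
  `x`-RESCALED monic polynomial `λ^{d-1} φ₂(x/λ, y)`; the resultant `Pbar = Res_{d,d}(ψ₀, ψ₀')` of
  `ψ₀ = genF0 d bgen`;
* weighted homogeneity in the coefficient variables (weight `1` on `c_e`, `0` on parameters):
  `ϕc`, `lamgen` have weight `1`, `bgen (i,j)` weight `d - i`, `tauR d bgen t` weight `W_t`
  (`Wτ`-bounded), `Pbar` weight `d (d - 1)`; and `1`-norm bounds `‖ϕc‖, ‖λ‖ ≤ A₀ = |S_d| 3^d`,
  `‖tauR d bgen t‖ ≤ Bτ d · A₀^{Wτ d}`, `‖Pbar‖ ≤ (2d)! ((d+1) A₀^d)^d (A₀^d)^d`.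

Semantics (evaluation at a specific `f` and parameter point) and the assembly are in the sequel.

## References

* E. Kaltofen, J. Comput. System Sci. 50 (1995) 274–295, §4 (30)–(31), §5 (34). [`Kaltofen1995`]
-/

noncomputable section

open Polynomial
open scoped Matrix

namespace Literature.RingTheory.MvPolynomial.NoetherForms

open _root_.MvPolynomial (IsWeightedHomogeneous IsHomogeneous)

/-! ### Coefficients of parameter monomials in a flat polynomial ring `ℤ[α ⊕ β]` -/

section PCoeff

variable {α β : Type*}

/-- The `α`-part of an exponent vector on `α ⊕ β`. [folklore] -/
def lpart (u : α ⊕ β →₀ ℕ) : α →₀ ℕ := (Finsupp.sumFinsuppAddEquivProdFinsupp u).1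

/-- The `β`-part of an exponent vector on `α ⊕ β`. [folklore] -/
def rpart (u : α ⊕ β →₀ ℕ) : β →₀ ℕ := (Finsupp.sumFinsuppAddEquivProdFinsupp u).2

/-- `lpart u a = u (inl a)`. [folklore] -/
@[simp] theorem lpart_apply (u : α ⊕ β →₀ ℕ) (a : α) : lpart u a = u (Sum.inl a) :=
  Finsupp.fst_sumFinsuppAddEquivProdFinsupp u a

/-- `rpart u b = u (inr b)`. [folklore] -/
@[simp] theorem rpart_apply (u : α ⊕ β →₀ ℕ) (b : β) : rpart u b = u (Sum.inr b) :=
  Finsupp.snd_sumFinsuppAddEquivProdFinsupp u b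

/-- Reassembling: `u = (lpart u).sumElim (rpart u)`. [folklore] -/
theorem sumElim_lpart_rpart (u : α ⊕ β →₀ ℕ) : (lpart u).sumElim (rpart u) = u := by
  ext x
  rcases x with a | b <;> simp [Finsupp.sumElim_apply]

/-- `lpart` is additive. [folklore] -/
theorem lpart_add (u u' : α ⊕ β →₀ ℕ) : lpart (u + u') = lpart u + lpart u' := by
  ext a; simp

/-- `rpart` is additive. [folklore] -/
theorem rpart_add (u u' : α ⊕ β →₀ ℕ) : rpart (u + u') = rpart u + rpart u' := by
  ext b; simp

/-- The weight of `u` for weights supported on `β` is the weight of `rpart u`. [folklore] -/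
theorem weight_sumElim_zero {M : Type*} [AddCommMonoid M] (w : β → M) (u : α ⊕ β →₀ ℕ) :
    Finsupp.weight (Sum.elim (fun _ => (0 : M)) w) u = Finsupp.weight w (rpart u) := by
  conv_lhs => rw [← sumElim_lpart_rpart u]
  rw [Finsupp.weight_apply, Finsupp.weight_apply, Finsupp.sum_sumElim]
  simp [Function.comp_def]

variable [DecidableEq α]

/-- `pcoeff m P ∈ ℤ[β]`: the coefficient of the `α`-monomial `m` in `P ∈ ℤ[α ⊕ β]`. [folklore] -/
def pcoeff (m : α →₀ ℕ) (P : MvPolynomial (α ⊕ β) ℤ) : MvPolynomial β ℤ :=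
  ∑ u ∈ P.support with lpart u = m, MvPolynomial.monomial (rpart u) (P.coeff u)

/-- THE EVALUATION IDENTITY: `P(p, q) = Σ_m p^m · (pcoeff m P)(q)`, the sum over the `α`-parts of the
support. [folklore] -/
theorem aeval_sumElim_eq {T : Type*} [CommRing T] (p : α → T) (q : β → T)
    (P : MvPolynomial (α ⊕ β) ℤ) :
    MvPolynomial.aeval (Sum.elim p q) P =
      ∑ m ∈ P.support.image lpart, (m.prod fun a k => p a ^ k) * MvPolynomial.aeval q (pcoeff m P) := by
  classical
  have key : ∀ u : α ⊕ β →₀ ℕ, MvPolynomial.aeval (Sum.elim p q) (MvPolynomial.monomial u (P.coeff u)) =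
      ((lpart u).prod fun a k => p a ^ k) *
        MvPolynomial.aeval q (MvPolynomial.monomial (rpart u) (P.coeff u)) := by
    intro u
    rw [MvPolynomial.aeval_monomial, MvPolynomial.aeval_monomial, ← sumElim_lpart_rpart u,
      Finsupp.prod_sumElim, sumElim_lpart_rpart]
    simp only [Function.comp_def, Sum.elim_inl, Sum.elim_inr]
    ring
  conv_lhs => rw [P.as_sum, map_sum]
  rw [← Finset.sum_fiberwise_of_maps_to (g := lpart) (t := P.support.image lpart)
    (fun u hu => Finset.mem_image_of_mem lpart hu)]
  refine Finset.sum_congr rfl fun m _ => ?_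
  rw [pcoeff, map_sum, Finset.mul_sum]
  refine Finset.sum_congr rfl fun u hu => ?_
  rw [Finset.mem_filter] at hu
  rw [key u, hu.2]

/-- Homogeneity: if `P` is weighted homogeneous for weights vanishing on `α`, then `pcoeff m P` is
weighted homogeneous of the same weight for the restricted weights. [folklore] -/
theorem isWeightedHomogeneous_pcoeff {M : Type*} [AddCommMonoid M] {w : β → M}
    {P : MvPolynomial (α ⊕ β) ℤ} {W : M} (hP : IsWeightedHomogeneous (Sum.elim (fun _ => (0 : M)) w) P W)
    (m : α →₀ ℕ) : IsWeightedHomogeneous w (pcoeff m P) W := by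
  classical
  unfold pcoeff
  refine MvPolynomial.IsWeightedHomogeneous.sum _ _ _ fun u hu => ?_
  rw [Finset.mem_filter] at hu
  refine MvPolynomial.isWeightedHomogeneous_monomial _ _ _ ?_
  rw [← weight_sumElim_zero w u]
  exact hP (MvPolynomial.mem_support_iff.mp hu.1)

/-- Norm: `‖pcoeff m P‖₁ ≤ ‖P‖₁`. [folklore] -/
theorem l1Norm_pcoeff_le (m : α →₀ ℕ) (P : MvPolynomial (α ⊕ β) ℤ) : l1Norm (pcoeff m P) ≤ l1Norm P := by
  classical
  unfold pcoeff
  refine (l1Norm_sum_le _ _).trans ?_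
  calc ∑ u ∈ P.support with lpart u = m, l1Norm (MvPolynomial.monomial (rpart u) (P.coeff u))
        = ∑ u ∈ P.support with lpart u = m, (P.coeff u).natAbs :=
          Finset.sum_congr rfl fun u _ => l1Norm_monomial _ _
    _ ≤ ∑ u ∈ P.support, (P.coeff u).natAbs :=
          Finset.sum_le_sum_of_subset_of_nonneg (Finset.filter_subset _ _) fun _ _ _ => Nat.zero_le _
    _ = l1Norm P := rfl

/-- If `(pcoeff m P)(q) ≠ 0` for some `m` then `P(p, q) ≠ 0` for some `p`, over an infinite
integral domain. [folklore] -/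
theorem exists_aeval_sumElim_ne_zero {T : Type*} [CommRing T] [IsDomain T] [Infinite T] (q : β → T)
    (P : MvPolynomial (α ⊕ β) ℤ) {m : α →₀ ℕ} (hm : MvPolynomial.aeval q (pcoeff m P) ≠ 0) :
    ∃ p : α → T, MvPolynomial.aeval (Sum.elim p q) P ≠ 0 := by
  classical
  -- the polynomial in the parameters with coefficients `(pcoeff m P)(q)`
  set Pq : MvPolynomial α T :=
    ∑ m' ∈ P.support.image lpart, MvPolynomial.monomial m' (MvPolynomial.aeval q (pcoeff m' P)) with hPq
  have heval : ∀ p : α → T, MvPolynomial.eval p Pq = MvPolynomial.aeval (Sum.elim p q) P := by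
    intro p
    rw [aeval_sumElim_eq, hPq, map_sum]
    refine Finset.sum_congr rfl fun m' _ => ?_
    rw [MvPolynomial.eval_monomial, mul_comm]
  have hmem : m ∈ P.support.image lpart := by
    by_contra hnot
    apply hm
    have : pcoeff m P = 0 := by
      unfold pcoeff
      refine Finset.sum_eq_zero fun u hu => ?_
      rw [Finset.mem_filter] at hu
      exact (hnot (Finset.mem_image.mpr ⟨u, hu.1, hu.2⟩)).elim
    rw [this, map_zero]
  have hne : Pq ≠ 0 := by
    intro h0
    apply hm
    have hc := congrArg (MvPolynomial.coeff m) h0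
    rw [hPq, MvPolynomial.coeff_sum, MvPolynomial.coeff_zero] at hc
    simp only [MvPolynomial.coeff_monomial] at hc
    rwa [Finset.sum_ite_eq' (P.support.image lpart) m, if_pos hmem] at hc
  by_contra hall
  push Not at hall
  exact hne (MvPolynomial.funext fun p => by rw [heval, hall p, map_zero])

/-- `pcoeff m P = 0` unless `m` is the `α`-part of a monomial of `P`. [folklore] -/
theorem pcoeff_eq_zero_of_not_mem {m : α →₀ ℕ} {P : MvPolynomial (α ⊕ β) ℤ} (h : m ∉ P.support.image lpart) :
    pcoeff m P = 0 := by
  unfold pcoeff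
  refine Finset.sum_eq_zero fun u hu => ?_
  rw [Finset.mem_filter] at hu
  exact (h (Finset.mem_image.mpr ⟨u, hu.1, hu.2⟩)).elim

/-- `pcoeff m 0 = 0`. [folklore] -/
theorem pcoeff_zero (m : α →₀ ℕ) : pcoeff m (0 : MvPolynomial (α ⊕ β) ℤ) = 0 := by
  simp [pcoeff]

/-- Conversely `P(p, q) = 0` for all `p` when every `(pcoeff m P)(q) = 0`. [folklore] -/
theorem aeval_sumElim_eq_zero {T : Type*} [CommRing T] (p : α → T) (q : β → T)
    (P : MvPolynomial (α ⊕ β) ℤ) (h : ∀ m, MvPolynomial.aeval q (pcoeff m P) = 0) :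
    MvPolynomial.aeval (Sum.elim p q) P = 0 := by
  rw [aeval_sumElim_eq]
  exact Finset.sum_eq_zero fun m _ => by rw [h m, mul_zero]

end PCoeff

/-! ### Coefficientwise weighted homogeneity in `R[σ][y]` and `R[σ][y][x]` (variables of weight `0`) -/

section CoefHom

variable {σ R M : Type*} [CommRing R] [AddCommMonoid M] {w : σ → M}

/-- `CH1 w Q W`: every coefficient of `Q ∈ R[σ][y]` is weighted homogeneous of weight `W`. [folklore] -/
def CH1 (w : σ → M) (Q : Polynomial (MvPolynomial σ R)) (W : M) : Prop :=
  ∀ j, IsWeightedHomogeneous w (Q.coeff j) W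

/-- `CH2 w P W`: every coefficient of `P ∈ R[σ][y][x]` is weighted homogeneous of weight `W`. [folklore] -/
def CH2 (w : σ → M) (P : Polynomial (Polynomial (MvPolynomial σ R))) (W : M) : Prop :=
  ∀ i, CH1 w (P.coeff i) W

namespace CH1

/-- `0`. [folklore] -/
theorem zero (W : M) : CH1 w (0 : Polynomial (MvPolynomial σ R)) W :=
  fun _ => MvPolynomial.isWeightedHomogeneous_zero R w _

/-- Constants. [folklore] -/
theorem C {a : MvPolynomial σ R} {W : M} (ha : IsWeightedHomogeneous w a W) : CH1 w (Polynomial.C a) W := by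
  intro j
  rw [Polynomial.coeff_C]
  split_ifs
  · exact ha
  · exact MvPolynomial.isWeightedHomogeneous_zero R w _

/-- The variable has weight `0`. [folklore] -/
theorem X : CH1 w (Polynomial.X : Polynomial (MvPolynomial σ R)) 0 := by
  intro j
  rw [Polynomial.coeff_X]
  split_ifs
  · exact MvPolynomial.isWeightedHomogeneous_one R w
  · exact MvPolynomial.isWeightedHomogeneous_zero R w _

/-- Sums. [folklore] -/
theorem add {P Q : Polynomial (MvPolynomial σ R)} {W : M} (hP : CH1 w P W) (hQ : CH1 w Q W) :
    CH1 w (P + Q) W := fun j => by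
  rw [Polynomial.coeff_add]
  exact (hP j).add (hQ j)

/-- Finite sums. [folklore] -/
theorem sum {ι : Type*} (s : Finset ι) (f : ι → Polynomial (MvPolynomial σ R)) (W : M)
    (h : ∀ i ∈ s, CH1 w (f i) W) : CH1 w (∑ i ∈ s, f i) W := by
  classical
  induction s using Finset.induction_on with
  | empty => simpa using CH1.zero (w := w) (R := R) W
  | insert a s ha ih =>
    rw [Finset.sum_insert ha]
    exact (h a (Finset.mem_insert_self a s)).add (ih fun i hi => h i (Finset.mem_insert_of_mem hi))

/-- Products: weights add. [folklore] -/
theorem mul {P Q : Polynomial (MvPolynomial σ R)} {W W' : M} (hP : CH1 w P W) (hQ : CH1 w Q W') :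
    CH1 w (P * Q) (W + W') := fun j => by
  rw [Polynomial.coeff_mul]
  exact MvPolynomial.IsWeightedHomogeneous.sum _ _ _ fun x _ => (hP x.1).mul (hQ x.2)

/-- Powers. [folklore] -/
theorem pow {P : Polynomial (MvPolynomial σ R)} {W : M} (hP : CH1 w P W) (n : ℕ) : CH1 w (P ^ n) (n • W) := by
  induction n with
  | zero => simpa using CH1.C (w := w) (MvPolynomial.isWeightedHomogeneous_one R w)
  | succ n ih => rw [pow_succ, succ_nsmul]; exact ih.mul hP

end CH1

namespace CH2

/-- `0`. [folklore] -/
theorem zero (W : M) : CH2 w (0 : Polynomial (Polynomial (MvPolynomial σ R))) W := fun _ => by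
  rw [Polynomial.coeff_zero]; exact CH1.zero W

/-- Constants. [folklore] -/
theorem C {Q : Polynomial (MvPolynomial σ R)} {W : M} (hQ : CH1 w Q W) : CH2 w (Polynomial.C Q) W := by
  intro i
  rw [Polynomial.coeff_C]
  split_ifs
  · exact hQ
  · exact CH1.zero W

/-- The variable has weight `0`. [folklore] -/
theorem X : CH2 w (Polynomial.X : Polynomial (Polynomial (MvPolynomial σ R))) 0 := by
  intro i
  rw [Polynomial.coeff_X]
  split_ifs
  · simpa using CH1.C (w := w) (MvPolynomial.isWeightedHomogeneous_one R w)
  · exact CH1.zero 0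

/-- Sums. [folklore] -/
theorem add {P Q : Polynomial (Polynomial (MvPolynomial σ R))} {W : M} (hP : CH2 w P W) (hQ : CH2 w Q W) :
    CH2 w (P + Q) W := fun i => by
  rw [Polynomial.coeff_add]
  exact (hP i).add (hQ i)

/-- Finite sums. [folklore] -/
theorem sum {ι : Type*} (s : Finset ι) (f : ι → Polynomial (Polynomial (MvPolynomial σ R))) (W : M)
    (h : ∀ i ∈ s, CH2 w (f i) W) : CH2 w (∑ i ∈ s, f i) W := by
  classical
  induction s using Finset.induction_on with
  | empty => simpa using CH2.zero (w := w) (R := R) W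
  | insert a s ha ih =>
    rw [Finset.sum_insert ha]
    exact (h a (Finset.mem_insert_self a s)).add (ih fun i hi => h i (Finset.mem_insert_of_mem hi))

/-- Products: weights add. [folklore] -/
theorem mul {P Q : Polynomial (Polynomial (MvPolynomial σ R))} {W W' : M} (hP : CH2 w P W)
    (hQ : CH2 w Q W') : CH2 w (P * Q) (W + W') := fun i => by
  rw [Polynomial.coeff_mul]
  exact CH1.sum _ _ _ fun x _ => (hP x.1).mul (hQ x.2)

/-- Powers. [folklore] -/
theorem pow {P : Polynomial (Polynomial (MvPolynomial σ R))} {W : M} (hP : CH2 w P W) (n : ℕ) :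
    CH2 w (P ^ n) (n • W) := by
  induction n with
  | zero => simpa using CH2.C (CH1.C (w := w) (MvPolynomial.isWeightedHomogeneous_one R w))
  | succ n ih => rw [pow_succ, succ_nsmul]; exact ih.mul hP

/-- Finite products of weight-`0` factors. [folklore] -/
theorem prod_zero {ι : Type*} (s : Finset ι) (f : ι → Polynomial (Polynomial (MvPolynomial σ R)))
    (h : ∀ i ∈ s, CH2 w (f i) 0) : CH2 w (∏ i ∈ s, f i) 0 := by
  classical
  induction s using Finset.induction_on with
  | empty => simpa using CH2.C (CH1.C (w := w) (MvPolynomial.isWeightedHomogeneous_one R w))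
  | insert a s ha ih =>
    rw [Finset.prod_insert ha]
    simpa using (h a (Finset.mem_insert_self a s)).mul (ih fun i hi => h i (Finset.mem_insert_of_mem hi))

end CH2

end CoefHom

/-! ### The flat ring of parameters and coefficients; the generic substitution -/

section Generic

variable (n d : ℕ)

/-- Parameter indices: `(0, i) = vᵢ` (translations), `(1, i) = wᵢ` (slopes in `x`), `(2, i) = zᵢ`
(slopes in `y`); `w₀`, `z₀` are unused dummies. [cite: Kaltofen1995, §4 (before Lemma 2)] -/
abbrev PIdx (n : ℕ) := Fin 3 × Fin n

/-- Coefficient indices: exponents `e : Fin n →₀ ℕ` (the theorem's `c_{e₁,…,eₙ}`). [folklore] -/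
abbrev CIdx (n : ℕ) := Fin n →₀ ℕ

/-- All variables of the flat ring. [folklore] -/
abbrev V (n : ℕ) := PIdx n ⊕ CIdx n

/-- `𝔼 = ℤ[v, w, z, c]`. [folklore] -/
abbrev 𝔼 (n : ℕ) := MvPolynomial (V n) ℤ

/-- The weight counting only the coefficient variables: `w(c_e) = 1`, `w(param) = 0`. [folklore] -/
def wc (n : ℕ) : V n → ℕ := Sum.elim (fun _ => 0) (fun _ => 1)

/-- The coefficient variable `c_e`. [folklore] -/
abbrev cvar (e : CIdx n) : 𝔼 n := MvPolynomial.X (Sum.inr e)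

/-- The parameter variable of kind `k` and index `i`. [folklore] -/
abbrev pvar (k : Fin 3) (i : Fin n) : 𝔼 n := MvPolynomial.X (Sum.inl (k, i))

/-- The exponents of total degree `≤ d`. [folklore] -/
def Sd (n d : ℕ) : Finset (CIdx n) :=
  (Finset.range (d + 1)).biUnion fun k => (Finset.univ : Finset (Fin n)).finsuppAntidiag k

/-- Membership in `Sd`. [folklore] -/
theorem mem_Sd {e : CIdx n} : e ∈ Sd n d ↔ e.degree ≤ d := by
  unfold Sd
  simp only [Finset.mem_biUnion, Finset.mem_range, Finset.mem_finsuppAntidiag, Finset.subset_univ,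
    and_true, Nat.lt_succ_iff]
  constructor
  · rintro ⟨k, hk, hsum⟩
    rw [Finsupp.degree_eq_sum]
    have : ∑ i, e i = k := by rw [← hsum]
    omega
  · intro h
    exact ⟨e.degree, h, by rw [Finsupp.degree_eq_sum]⟩

/-- The generic degree-`≤ d` polynomial `f = Σ_{|e| ≤ d} c_e X^e` with coefficients in `𝔼`.
[cite: Kaltofen1995, Thm. 7 (proof: "we write `f` as a generic `d`-degree polynomial")] -/
def fgen : MvPolynomial (Fin n) (𝔼 n) :=
  ∑ e ∈ Sd n d, MvPolynomial.C (cvar n e) * MvPolynomial.monomial e 1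

/-- Inner-constant embedding `𝔼 → 𝔼[y][x]`. [folklore] -/
abbrev CC : 𝔼 n →+* Polynomial (Polynomial (𝔼 n)) :=
  (Polynomial.C : Polynomial (𝔼 n) →+* _).comp Polynomial.C

/-- The generic affine substitution `X₀ ↦ x + v₀`, `Xᵢ ↦ wᵢ x + zᵢ y + vᵢ` (`i ≥ 1`), with values in
`𝔼[y][x]`. [cite: Kaltofen1995, §5 (`φ₂`)] -/
def sgen (i : Fin n) : Polynomial (Polynomial (𝔼 n)) :=
  if (i : ℕ) = 0 then Polynomial.X + CC n (pvar n 0 i)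
  else CC n (pvar n 1 i) * Polynomial.X + Polynomial.C (Polynomial.C (pvar n 2 i) * Polynomial.X) +
    CC n (pvar n 0 i)

/-- `Φgen = f(x + v₀, w₁x + z₁y + v₁, …) ∈ 𝔼[y][x]`, Kaltofen's generic `φ₂`. [cite: Kaltofen1995, §5 (`φ₂`)] -/
def Φgen : Polynomial (Polynomial (𝔼 n)) := MvPolynomial.aeval (sgen n) (fgen n d)

/-- The coefficient of `xⁱ yʲ` in `Φgen`. [folklore] -/
def ϕc (i j : ℕ) : 𝔼 n := ((Φgen n d).coeff i).coeff j

/-- `λ = ldcf_x(φ₂)`, the coefficient of `x^d` ((30) of [Kaltofen1995]). [cite: Kaltofen1995, §4 (30)] -/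
def lamgen : 𝔼 n := ϕc n d d 0

/-- The coefficient vector of the `x`-RESCALED monic polynomial `λ^{d-1} φ₂(x/λ, y)`:
`bgen (i, j) = ϕc i j · λ^{d-1-i}` (this replaces Kaltofen's `ψ₂ = φ₂/λ` and the clearing of the
denominators `λ^D`). [folklore] -/
def bgen (ij : Idx d) : 𝔼 n := ϕc n d ij.1 ij.2 * lamgen n d ^ (d - 1 - (ij.1 : ℕ))

/-- `Pbar = Res_{d,d}(ψ₀, ψ₀')`, `ψ₀ = genF0 d bgen` — our version of Kaltofen's resultant numerator
`ρ̄` ((31)); formal degrees `(d, d)` so that Schmidt's isobaric/norm lemmas apply verbatim (for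
monic `ψ₀` this is `Res_{d, deg ψ₀'}(ψ₀, ψ₀')`). [cite: Kaltofen1995, §4 (31)] -/
def Pbar : 𝔼 n := (genF0 d (bgen n d)).resultant (derivative (genF0 d (bgen n d))) d d

/-! ### Weights of the generic objects -/

/-- `c_e` has weight `1`. [folklore] -/
theorem isWeightedHomogeneous_cvar (e : CIdx n) : IsWeightedHomogeneous (wc n) (cvar n e) 1 := by
  simpa [wc] using MvPolynomial.isWeightedHomogeneous_X ℤ (wc n) (Sum.inr e)

/-- Parameters have weight `0`. [folklore] -/
theorem isWeightedHomogeneous_pvar (k : Fin 3) (i : Fin n) : IsWeightedHomogeneous (wc n) (pvar n k i) 0 := by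
  simpa [wc] using MvPolynomial.isWeightedHomogeneous_X ℤ (wc n) (Sum.inl (k, i))

/-- The substituted forms have coefficientwise weight `0`. [folklore] -/
theorem CH2_sgen (i : Fin n) : CH2 (wc n) (sgen n i) 0 := by
  unfold sgen
  split_ifs
  · exact CH2.X.add (CH2.C (CH1.C (isWeightedHomogeneous_pvar n 0 i)))
  · refine CH2.add (CH2.add ?_ (CH2.C ?_)) (CH2.C (CH1.C (isWeightedHomogeneous_pvar n 0 i)))
    · simpa using (CH2.C (CH1.C (isWeightedHomogeneous_pvar n 1 i))).mul (CH2.X (w := wc n) (R := ℤ))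
    · simpa using (CH1.C (isWeightedHomogeneous_pvar n 2 i)).mul (CH1.X (w := wc n) (R := ℤ))

/-- `Φgen` is coefficientwise of weight `1` (linear in the `c_e`). [folklore] -/
theorem CH2_Φgen : CH2 (wc n) (Φgen n d) 1 := by
  unfold Φgen fgen
  rw [map_sum]
  refine CH2.sum _ _ _ fun e _ => ?_
  rw [map_mul, MvPolynomial.aeval_C, MvPolynomial.aeval_monomial, map_one, one_mul]
  have h1 : CH2 (wc n) (algebraMap (𝔼 n) (Polynomial (Polynomial (𝔼 n))) (cvar n e)) 1 :=
    CH2.C (CH1.C (isWeightedHomogeneous_cvar n e))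
  have h2 : CH2 (wc n) (e.prod fun i k => sgen n i ^ k) 0 := by
    refine CH2.prod_zero _ _ fun i _ => ?_
    simpa using (CH2_sgen n i).pow (e i)
  simpa using h1.mul h2

/-- `ϕc i j` has weight `1`. [folklore] -/
theorem isWeightedHomogeneous_ϕc (i j : ℕ) : IsWeightedHomogeneous (wc n) (ϕc n d i j) 1 :=
  CH2_Φgen n d i j

/-- `λ` has weight `1` ("deg_{c's}(λ) = 1", proof of Thm. 7). [cite: Kaltofen1995, Thm. 7 (proof)] -/
theorem isWeightedHomogeneous_lamgen : IsWeightedHomogeneous (wc n) (lamgen n d) 1 :=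
  isWeightedHomogeneous_ϕc n d d 0

/-- `bgen (i, j)` has weight `d - i`. [folklore] -/
theorem isWeightedHomogeneous_bgen (ij : Idx d) :
    IsWeightedHomogeneous (wc n) (bgen n d ij) (d - (ij.1 : ℕ)) := by
  have h := (isWeightedHomogeneous_ϕc n d ij.1 ij.2).mul ((isWeightedHomogeneous_lamgen n d).pow
    (d - 1 - (ij.1 : ℕ)))
  have hi := ij.1.2
  rw [bgen]
  convert h using 1
  simp only [smul_eq_mul, mul_one]
  omega

/-- The weights `wt d (i, j) = d - i` are the casts of the natural weights `d - i`. [folklore] -/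
theorem wt_eq_natCast (ij : Idx d) : wt d ij = ((d - (ij.1 : ℕ) : ℕ) : ℤ) := by
  rw [wt, Nat.cast_sub ij.1.2.le]

/-- WEIGHTED SUBSTITUTION, homogeneity: substituting weight-`(d - i)` polynomials `b (i, j)` into a
`wt`-homogeneous `τ` of weight `W` gives a `wc`-homogeneous polynomial of weight `W`. [folklore] -/
theorem isWeightedHomogeneous_aeval {σ : Type*} {w : σ → ℕ} {τ : MvPolynomial (Idx d) ℤ} {W : ℤ}
    (hτ : IsWeightedHomogeneous (wt d) τ W) {b : Idx d → MvPolynomial σ ℤ}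
    (hb : ∀ ij, IsWeightedHomogeneous w (b ij) (d - (ij.1 : ℕ))) {W' : ℕ} (hW : (W' : ℤ) = W) :
    IsWeightedHomogeneous w (MvPolynomial.aeval b τ) W' := by
  classical
  conv => arg 2; rw [τ.as_sum, map_sum]
  refine MvPolynomial.IsWeightedHomogeneous.sum _ _ _ fun m hm => ?_
  rw [MvPolynomial.aeval_monomial]
  have hprod := MvPolynomial.IsWeightedHomogeneous.prod m.support (fun ij => b ij ^ m ij)
    (fun ij => m ij • (d - (ij.1 : ℕ))) (fun ij _ => (hb ij).pow _)
  have hsum : ∑ ij ∈ m.support, m ij • (d - (ij.1 : ℕ)) = W' := by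
    have h1 : (Finsupp.weight (wt d) m : ℤ) = W := hτ (MvPolynomial.mem_support_iff.mp hm)
    have h2 : (Finsupp.weight (wt d) m : ℤ) = ((∑ ij ∈ m.support, m ij • (d - (ij.1 : ℕ)) : ℕ) : ℤ) := by
      rw [Finsupp.weight_apply, Finsupp.sum]
      push_cast
      refine Finset.sum_congr rfl fun ij _ => ?_
      rw [wt_eq_natCast, nsmul_eq_mul, smul_eq_mul]
      push_cast
      ring
    have : ((∑ ij ∈ m.support, m ij • (d - (ij.1 : ℕ)) : ℕ) : ℤ) = W' := by rw [← h2, h1, hW]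
    exact_mod_cast this
  rw [hsum] at hprod
  rw [MvPolynomial.algebraMap_eq]
  exact hprod.C_mul _

/-- WEIGHTED SUBSTITUTION, norm: with `‖b (i, j)‖₁ ≤ A^{d-i}`,
`‖τ(b)‖₁ ≤ ‖τ‖₁ A^W` (cf. Schmidt's Lemma 1E, `l1Norm_bind₁_le`, in weighted form; Kaltofen,
proof of Thm. 7: "`‖τ‖₁ ≤ max ‖Δ‖₁ · A^D`"). [cite: Kaltofen1995, Thm. 7 (proof)] -/
theorem l1Norm_aeval_le {σ : Type*} {τ : MvPolynomial (Idx d) ℤ} {W : ℤ}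
    (hτ : IsWeightedHomogeneous (wt d) τ W) {b : Idx d → MvPolynomial σ ℤ} {A : ℕ}
    (hb : ∀ ij, l1Norm (b ij) ≤ A ^ (d - (ij.1 : ℕ))) {W' : ℕ} (hW : (W' : ℤ) = W) :
    l1Norm (MvPolynomial.aeval b τ) ≤ l1Norm τ * A ^ W' := by
  classical
  conv_lhs => rw [τ.as_sum, map_sum]
  refine (l1Norm_sum_le _ _).trans ?_
  rw [l1Norm, Finset.sum_mul]
  refine Finset.sum_le_sum fun m hm => ?_
  rw [MvPolynomial.aeval_monomial, MvPolynomial.algebraMap_eq]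
  refine (l1Norm_mul_le _ _).trans ?_
  rw [l1Norm_C]
  refine Nat.mul_le_mul_left _ ((l1Norm_prod_le _ _).trans ?_)
  have hsum : ∑ ij ∈ m.support, m ij * (d - (ij.1 : ℕ)) = W' := by
    have h1 : (Finsupp.weight (wt d) m : ℤ) = W := hτ (MvPolynomial.mem_support_iff.mp hm)
    have h2 : (Finsupp.weight (wt d) m : ℤ) = ((∑ ij ∈ m.support, m ij * (d - (ij.1 : ℕ)) : ℕ) : ℤ) := by
      rw [Finsupp.weight_apply, Finsupp.sum]
      push_cast
      refine Finset.sum_congr rfl fun ij _ => ?_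
      rw [wt_eq_natCast, nsmul_eq_mul]
    have : ((∑ ij ∈ m.support, m ij * (d - (ij.1 : ℕ)) : ℕ) : ℤ) = W' := by rw [← h2, h1, hW]
    exact_mod_cast this
  calc ∏ ij ∈ m.support, l1Norm (b ij ^ m ij) ≤ ∏ ij ∈ m.support, A ^ (m ij * (d - (ij.1 : ℕ))) := by
        refine Finset.prod_le_prod (fun _ _ => Nat.zero_le _) fun ij _ => (l1Norm_pow_le _ _).trans ?_
        rw [mul_comm, pow_mul]
        exact Nat.pow_le_pow_left (hb ij) _
    _ = A ^ W' := by rw [Finset.prod_pow_eq_pow_sum, hsum]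

/-- `tauR d bgen t` is the substitution of `bgen` into the integer form `tauR d X t`. [folklore] -/
theorem tauR_bgen_eq (t : TIdx d) :
    tauR d (bgen n d) t = MvPolynomial.aeval (bgen n d) (tauR d (aX d) t) := by
  have h := map_tauR d (aX d) (↑(MvPolynomial.aeval (bgen n d) : E₂ d →ₐ[ℤ] 𝔼 n) : E₂ d →+* 𝔼 n) t
  rw [RingHom.coe_coe] at h
  rw [h]
  congr 1
  ext ij : 1
  simp [aX]

/-- **Weight of the τ-forms**: `tauR d bgen t` is `wc`-homogeneous of weight `W_S - ι` (as a natural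
number `W'`). [cite: Kaltofen1995, Thm. 7 (proof: `deg_{c's}(τ) ≤ D`)] -/
theorem isWeightedHomogeneous_tauR_bgen (t : TIdx d) {W' : ℕ} (hW : (W' : ℤ) = minorWeight d t.1 - (t.2 : ℕ)) :
    IsWeightedHomogeneous (wc n) (tauR d (bgen n d) t) W' := by
  rw [tauR_bgen_eq]
  exact isWeightedHomogeneous_aeval d (isWeightedHomogeneous_tauR d t) (isWeightedHomogeneous_bgen n d) hW

/-! ### Norms of the generic objects -/

/-- The joint `1`-norm on `𝔼[y]`. [folklore] -/
def N1 (n : ℕ) : RingSeminorm (Polynomial (𝔼 n)) := (l1Seminorm (V n)).polynomial 1 zero_le_one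

/-- The joint `1`-norm on `𝔼[y][x]`. [folklore] -/
def N2 (n : ℕ) : RingSeminorm (Polynomial (Polynomial (𝔼 n))) := (N1 n).polynomial 1 zero_le_one

/-- `N1 (C a) = ‖a‖₁`. [folklore] -/
@[simp] theorem N1_C (a : 𝔼 n) : N1 n (Polynomial.C a) = l1Norm a := by
  rw [N1, RingSeminorm.polynomial_apply, polyNorm_C, l1Seminorm_apply]

/-- `N1 y = 1`. [folklore] -/
@[simp] theorem N1_X : N1 n Polynomial.X = 1 := by
  rw [N1, RingSeminorm.polynomial_apply, ← monomial_one_one_eq_X, polyNorm_monomial, l1Seminorm_apply,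
    l1Norm_one]
  simp

/-- `N2 (C Q) = N1 Q`. [folklore] -/
@[simp] theorem N2_C (Q : Polynomial (𝔼 n)) : N2 n (Polynomial.C Q) = N1 n Q := by
  rw [N2, RingSeminorm.polynomial_apply, polyNorm_C]

/-- `N2 x = 1`. [folklore] -/
@[simp] theorem N2_X : N2 n Polynomial.X = 1 := by
  rw [N2, RingSeminorm.polynomial_apply, ← monomial_one_one_eq_X, polyNorm_monomial, ← Polynomial.C_1, N1_C,
    l1Norm_one]
  simp

/-- `N2 (CC a) = ‖a‖₁`. [folklore] -/
theorem N2_CC (a : 𝔼 n) : N2 n (CC n a) = l1Norm a := by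
  rw [RingHom.comp_apply, N2_C, N1_C]

/-- Coefficient domination: `‖((P.coeff i).coeff j)‖₁ ≤ N2 P`. [folklore] -/
theorem l1Norm_coeff_coeff_le_N2 (P : Polynomial (Polynomial (𝔼 n))) (i j : ℕ) :
    (l1Norm ((P.coeff i).coeff j) : ℝ) ≤ N2 n P := by
  have h1 := le_polyNorm (N1 n) zero_le_one P i
  have h2 := le_polyNorm (l1Seminorm (V n)) zero_le_one (P.coeff i) j
  rw [one_pow, mul_one] at h1 h2
  rw [l1Seminorm_apply] at h2
  exact h2.trans h1

/-- `N2 (sgen i) ≤ 3`. [folklore] -/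
theorem N2_sgen_le (i : Fin n) : N2 n (sgen n i) ≤ 3 := by
  unfold sgen
  split_ifs
  · have h := map_add_le_add (N2 n) Polynomial.X (CC n (pvar n 0 i))
    rw [N2_X, N2_CC, l1Norm_X] at h
    norm_num at h ⊢
    linarith
  · set a : Polynomial (Polynomial (𝔼 n)) := CC n (pvar n 1 i) * Polynomial.X with ha
    set b : Polynomial (Polynomial (𝔼 n)) := Polynomial.C (Polynomial.C (pvar n 2 i) * Polynomial.X) with hb
    set c : Polynomial (Polynomial (𝔼 n)) := CC n (pvar n 0 i) with hc
    have h1 := map_add_le_add (N2 n) (a + b) c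
    have h2 := map_add_le_add (N2 n) a b
    have h3 : N2 n a ≤ 1 := by
      have := map_mul_le_mul (N2 n) (CC n (pvar n 1 i)) Polynomial.X
      rw [N2_CC, N2_X, l1Norm_X] at this
      norm_num at this
      exact this
    have h4 : N2 n b ≤ 1 := by
      rw [hb, N2_C]
      have := map_mul_le_mul (N1 n) (Polynomial.C (pvar n 2 i)) Polynomial.X
      rw [N1_C, N1_X, l1Norm_X] at this
      norm_num at this
      exact this
    have h5 : N2 n c = 1 := by rw [hc, N2_CC, l1Norm_X, Nat.cast_one]
    linarith

/-- The size constant `A₀ = |S_d| · 3^d ≥ ‖φ₂‖` (Kaltofen: `A = C(d+n, n) 3^d`). [cite: Kaltofen1995, Thm. 7 (proof: the constant `A`)] -/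
def A₀ (n d : ℕ) : ℕ := (Sd n d).card * 3 ^ d

/-- `N2 Φgen ≤ A₀`. [cite: Kaltofen1995, Thm. 7 (proof: "the 1-norm of the generic version of φ₂ … is bounded by A")] -/
theorem N2_Φgen_le : N2 n (Φgen n d) ≤ A₀ n d := by
  unfold Φgen fgen A₀
  rw [map_sum]
  refine (polyNorm_sum_le (N1 n) zero_le_one _ _).trans ?_
  have hone : N1 n 1 ≤ 1 := by rw [← Polynomial.C_1, N1_C, l1Norm_one, Nat.cast_one]
  calc ∑ e ∈ Sd n d, polyNorm (N1 n) 1 (MvPolynomial.aeval (sgen n) (MvPolynomial.C (cvar n e) * MvPolynomial.monomial e 1))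
        ≤ ∑ _e ∈ Sd n d, (3 : ℝ) ^ d := by
          refine Finset.sum_le_sum fun e he => ?_
          rw [map_mul, MvPolynomial.aeval_C, MvPolynomial.aeval_monomial, map_one, one_mul, ← RingSeminorm.polynomial_apply _ 1 zero_le_one]
          change N2 n _ ≤ _
          have h1 := map_mul_le_mul (N2 n) (algebraMap (𝔼 n) (Polynomial (Polynomial (𝔼 n))) (cvar n e))
            (e.prod fun i k => sgen n i ^ k)
          have h2 : N2 n (algebraMap (𝔼 n) (Polynomial (Polynomial (𝔼 n))) (cvar n e)) = 1 := by
            rw [show algebraMap (𝔼 n) (Polynomial (Polynomial (𝔼 n))) (cvar n e) = CC n (cvar n e) from rfl,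
              N2_CC, l1Norm_X, Nat.cast_one]
          have h3 : N2 n (e.prod fun i k => sgen n i ^ k) ≤ (3 : ℝ) ^ d := by
            rw [Finsupp.prod]
            refine (polyNorm_prod_le (N1 n) zero_le_one hone _ _).trans ?_
            calc ∏ i ∈ e.support, polyNorm (N1 n) 1 (sgen n i ^ e i) ≤ ∏ i ∈ e.support, (3 : ℝ) ^ e i := by
                  refine Finset.prod_le_prod (fun i _ => polyNorm_nonneg _ zero_le_one _) fun i _ => ?_
                  exact (polyNorm_pow_le (N1 n) zero_le_one hone _ _).trans
                    (pow_le_pow_left₀ (polyNorm_nonneg _ zero_le_one _) (N2_sgen_le n i) _)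
              _ = (3 : ℝ) ^ e.degree := by rw [Finset.prod_pow_eq_pow_sum]; rfl
              _ ≤ (3 : ℝ) ^ d := pow_le_pow_right₀ (by norm_num) ((mem_Sd n d).mp he)
          rw [h2, one_mul] at h1
          exact h1.trans h3
    _ = ((Sd n d).card * 3 ^ d : ℕ) := by rw [Finset.sum_const, nsmul_eq_mul]; push_cast; ring

/-- `1 ≤ A₀`. [folklore] -/
theorem one_le_A₀ : 1 ≤ A₀ n d := by
  unfold A₀
  have h0 : (0 : CIdx n) ∈ Sd n d := (mem_Sd n d).mpr (by simp)
  have : 1 ≤ (Sd n d).card := Finset.card_pos.mpr ⟨0, h0⟩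
  exact one_le_mul this (Nat.one_le_pow _ _ (by norm_num))

/-- `‖ϕc i j‖₁ ≤ A₀`. [cite: Kaltofen1995, Thm. 7 (proof: the constant `A`)] -/
theorem l1Norm_ϕc_le (i j : ℕ) : l1Norm (ϕc n d i j) ≤ A₀ n d := by
  have h : (l1Norm (ϕc n d i j) : ℝ) ≤ A₀ n d :=
    (l1Norm_coeff_coeff_le_N2 n (Φgen n d) i j).trans (N2_Φgen_le n d)
  exact_mod_cast h

/-- `‖bgen (i, j)‖₁ ≤ A₀^{d-i}`. [folklore] -/
theorem l1Norm_bgen_le (ij : Idx d) : l1Norm (bgen n d ij) ≤ A₀ n d ^ (d - (ij.1 : ℕ)) := by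
  rw [bgen]
  refine (l1Norm_mul_le _ _).trans ?_
  have hi := ij.1.2
  calc l1Norm (ϕc n d ij.1 ij.2) * l1Norm (lamgen n d ^ (d - 1 - (ij.1 : ℕ)))
        ≤ A₀ n d * A₀ n d ^ (d - 1 - (ij.1 : ℕ)) :=
          Nat.mul_le_mul (l1Norm_ϕc_le n d _ _) ((l1Norm_pow_le _ _).trans
            (Nat.pow_le_pow_left (l1Norm_ϕc_le n d d 0) _))
    _ = A₀ n d ^ (d - (ij.1 : ℕ)) := by
          rw [← pow_succ']
          congr 1
          omega

/-- **Norm of the τ-forms**: `‖tauR d bgen t‖₁ ≤ Bτ d · A₀^{W'}`. [cite: Kaltofen1995, Thm. 7 (proof: `‖τ‖₁ ≤ max ‖Δ‖₁ A^D`)] -/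
theorem l1Norm_tauR_bgen_le (hd : 0 < d) (t : TIdx d) {W' : ℕ}
    (hW : (W' : ℤ) = minorWeight d t.1 - (t.2 : ℕ)) :
    l1Norm (tauR d (bgen n d) t) ≤ Bτ d * A₀ n d ^ W' := by
  rw [tauR_bgen_eq]
  exact (l1Norm_aeval_le d (isWeightedHomogeneous_tauR d t) (l1Norm_bgen_le n d) hW).trans
    (Nat.mul_le_mul_right _ (l1Norm_tauR_le d hd t))

/-! ### The resultant `Pbar`: weight `d (d - 1)` and norm -/

/-- Integer weights from natural weights: homogeneity transfers. [folklore] -/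
theorem isWeightedHomogeneous_of_natCast {σ : Type*} {w : σ → ℕ} {φ : MvPolynomial σ ℤ} {W : ℕ} {W' : ℤ}
    (h : IsWeightedHomogeneous (fun x => (w x : ℤ)) φ W') (hW : (W : ℤ) = W') :
    IsWeightedHomogeneous w φ W := by
  intro m hm
  have h1 : (Finsupp.weight (fun x => (w x : ℤ)) m : ℤ) = W' := h hm
  have h2 : (Finsupp.weight (fun x => (w x : ℤ)) m : ℤ) = ((Finsupp.weight w m : ℕ) : ℤ) := by
    rw [Finsupp.weight_apply, Finsupp.weight_apply, Finsupp.sum, Finsupp.sum]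
    push_cast
    simp [smul_eq_mul]
  have : ((Finsupp.weight w m : ℕ) : ℤ) = W := by rw [← h2, h1, hW]
  exact_mod_cast this

/-- Natural weights to integer weights. [folklore] -/
theorem isWeightedHomogeneous_natCast {σ : Type*} {w : σ → ℕ} {φ : MvPolynomial σ ℤ} {W : ℕ}
    (h : IsWeightedHomogeneous w φ W) : IsWeightedHomogeneous (fun x => (w x : ℤ)) φ (W : ℤ) := by
  intro m hm
  have h1 : Finsupp.weight w m = W := h hm
  rw [Finsupp.weight_apply, Finsupp.sum]
  rw [Finsupp.weight_apply, Finsupp.sum] at h1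
  rw [← h1]
  push_cast
  simp [smul_eq_mul]

/-- The coefficients of `ψ₀ = genF0 d bgen`: weight `d - k` for `k ≤ d`. [folklore] -/
theorem isWeightedHomogeneous_coeff_genF0_bgen (k : ℕ) (hk : k ≤ d) :
    IsWeightedHomogeneous (fun x => (wc n x : ℤ)) ((genF0 d (bgen n d)).coeff k) ((0 : ℤ) + (d - k) • (1 : ℤ)) := by
  rw [coeff_genF0, zero_add, nsmul_eq_mul, mul_one]
  split_ifs with h1 h2
  · exact isWeightedHomogeneous_natCast (isWeightedHomogeneous_bgen n d (⟨k, h1⟩, 0))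
  · subst h2
    simpa using MvPolynomial.isWeightedHomogeneous_one ℤ (fun x => (wc n x : ℤ))
  · exact MvPolynomial.isWeightedHomogeneous_zero ℤ _ _

/-- The coefficients of `ψ₀'`: weight `-1 + (d - k)` for `k ≤ d`. [folklore] -/
theorem isWeightedHomogeneous_coeff_derivative_genF0_bgen (k : ℕ) (hk : k ≤ d) :
    IsWeightedHomogeneous (fun x => (wc n x : ℤ)) ((derivative (genF0 d (bgen n d))).coeff k)
      ((-1 : ℤ) + (d - k) • (1 : ℤ)) := by
  rw [coeff_derivative, show ((k : 𝔼 n) + 1) = MvPolynomial.C ((k : ℤ) + 1) by simp, mul_comm]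
  refine MvPolynomial.IsWeightedHomogeneous.C_mul ?_ _
  by_cases hk1 : k + 1 ≤ d
  · convert isWeightedHomogeneous_coeff_genF0_bgen n d (k + 1) hk1 using 1
    rw [zero_add, nsmul_eq_mul, nsmul_eq_mul, mul_one, mul_one, Nat.cast_sub hk, Nat.cast_sub hk1]
    push_cast
    ring
  · rw [coeff_genF0, dif_neg (by omega), if_neg (by omega)]
    exact MvPolynomial.isWeightedHomogeneous_zero ℤ _ _

/-- **Weight of `Pbar`**: `d (d - 1)` (Schmidt's isobaric resultant, `resultant_isWeightedHomogeneous`).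
[cite: Kaltofen1995, Thm. 7 (proof: `deg_{c's}(ρ̄) ≤ 2d - 1` — here through isobaricity)] -/
theorem isWeightedHomogeneous_Pbar (hd : 0 < d) : IsWeightedHomogeneous (wc n) (Pbar n d) (d * (d - 1)) := by
  have h := resultant_isWeightedHomogeneous (fun x => (wc n x : ℤ)) (genF0 d (bgen n d))
    (derivative (genF0 d (bgen n d))) d 0 (-1) 1
    (fun k hk => isWeightedHomogeneous_coeff_genF0_bgen n d k hk)
    (fun k hk => isWeightedHomogeneous_coeff_derivative_genF0_bgen n d k hk)
  refine isWeightedHomogeneous_of_natCast h ?_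
  rw [Nat.cast_mul, Nat.cast_sub hd]
  simp only [nsmul_eq_mul]
  push_cast
  ring

/-- The coefficients of `ψ₀` have norm `≤ A₀^d`. [folklore] -/
theorem l1Norm_coeff_genF0_bgen_le (k : ℕ) : l1Norm ((genF0 d (bgen n d)).coeff k) ≤ A₀ n d ^ d := by
  have hA := one_le_A₀ n d
  rw [coeff_genF0]
  split_ifs with h1 h2
  · exact (l1Norm_bgen_le n d _).trans (Nat.pow_le_pow_right hA (Nat.sub_le _ _))
  · rw [l1Norm_one]; exact Nat.one_le_pow _ _ hA
  · rw [l1Norm_zero]; exact Nat.zero_le _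

/-- The coefficients of `ψ₀'` have norm `≤ (d + 1) A₀^d`. [folklore] -/
theorem l1Norm_coeff_derivative_genF0_bgen_le (k : ℕ) :
    l1Norm ((derivative (genF0 d (bgen n d))).coeff k) ≤ (d + 1) * A₀ n d ^ d := by
  rw [coeff_derivative, show ((k : 𝔼 n) + 1) = MvPolynomial.C ((k : ℤ) + 1) by simp, mul_comm]
  refine (l1Norm_mul_le _ _).trans ?_
  rw [l1Norm_C]
  by_cases hk : k + 1 ≤ d
  · refine Nat.mul_le_mul ?_ (l1Norm_coeff_genF0_bgen_le n d _)
    have : ((k : ℤ) + 1).natAbs = k + 1 := by omega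
    omega
  · rw [coeff_genF0, dif_neg (by omega), if_neg (by omega), l1Norm_zero, mul_zero]
    exact Nat.zero_le _

/-- **Norm of `Pbar`**: `‖Pbar‖₁ ≤ (2d)! ((d+1) A₀^d)^d (A₀^d)^d` (Schmidt/Kaltofen: "this resultant is a
`2d × 2d` determinant"). [cite: Kaltofen1995, Thm. 7 (proof: `‖ρ̄‖₁ ≤ (2d-1)! A^{2d-1}`)] -/
theorem l1Norm_Pbar_le :
    l1Norm (Pbar n d) ≤ (d + d).factorial * (((d + 1) * A₀ n d ^ d) ^ d * (A₀ n d ^ d) ^ d) :=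
  l1Norm_resultant_le _ _ d _ _ (l1Norm_coeff_genF0_bgen_le n d) (l1Norm_coeff_derivative_genF0_bgen_le n d)

end Generic

end Literature.RingTheory.MvPolynomial.NoetherForms
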